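import Summits.HodgeConjecture.HodgeConjecture.Theorems.PadicSemiregularLiftAnchorsAtGenericHodgeLocusPointsCutOutBaseChange
import Summits.HodgeConjecture.HodgeConjecture.Theorems.PadicSemiregularLiftAnchorsAtGenericHodgeLocusPointsSmoothCutOut
import Summits.HodgeConjecture.HodgeConjecture.Theorems.PadicSemiregularLiftAnchorsAtGenericHodgeLocusPointsFermatLiftArith
import Summits.HodgeConjecture.HodgeConjecture.Theorems.PadicSemiregularLiftAnchorsAtGenericHodgeLocusPointsFermatPrimes
import Literature.AlgebraicGeometry.Motives.CurveNet
import HarnessLib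

/-!
# The Fermat lift over `W(k)` is a smooth proper model with Fermat fibres
# (helper for `AnchorsAtGenericHodgeLocusPoints`, stmt-HodgeConjecture-13944)

Route `PadicSemiregularLift` of `HodgeConjecture`, informal support item P2b
`AnchorsAtGenericHodgeLocusPoints`, Fermat half (B2): "`𝒳 = Xⁿₘ` over `W(𝔽̄_p)` is a `p`-adic anchor
((i) …; (ii): smooth hypersurface) … `𝒳_K ⊗_{K,ι} ℂ ≅ Y`". This file proves, unconditionally and over
the tree's real carriers, the GEOMETRIC (crystalline-package-free) clauses of that anchor:

* `exists_fermatLift_model` — for a prime `p`, an algebraically closed field `k` of characteristic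
  `p ≠ 2`, and `n ≥ 1`, `m ≥ 1` with `p ∤ m`, there is a `W(k)`-scheme `𝒳` which is a FERMAT LIFT
  (a closed `W(k)`-immersion into `ℙⁿ⁺¹_{W(k)}` onto `V₊(Σ xᵢᵐ)` — spelled out; this is verbatim the body
  of `Crystalline.IsFermatLift n m 𝒳` of `Literature/…/Crystalline/FermatLiftSeedDefs.lean`, whose olean
  is not available on the farm at the time of writing), projective over the ring `W(k)`, reduced,
  and a SMOOTH PROPER MODEL of relative dimension `n` (`WittScheme.IsSmoothProperModel n 𝒳`: smooth of
  relative dimension `n` and proper over `W(k)`, both fibres smooth projective geometrically integral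
  `n`-folds), whose special fibre `𝒳 ⊗ k`, generic fibre `𝒳_K` (`K = W(k)[1/p]`) and every base change
  `𝒳_K ⊗_{K,ι} L` along a field embedding `ι : K → L` are FERMAT VARIETIES `Xⁿₘ`
  (`Motives.IsFermatVariety n m`) — hence `L`-isomorphic to the standard complex/… Fermat hypersurface
  (`IsFermatVariety.nonempty_iso`): the fields `model`, `projective` of `Crystalline.IsPadicAnchor` and
  the comparison-of-varieties clause of (B2), for the anchor prime `p ≡ -1 (mod m)`, `p > n + 6` of
  `…FermatPrimes.lean`.

Assembly: the Fermat form is nonsingular over the domain `W(k)` (`…FermatLiftArith.lean`, `p ∤ m`),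
so the reduced cut-out `V₊(Σ xᵢᵐ) ⊆ ℙⁿ⁺¹_{W(k)}` is smooth of relative dimension `n` and proper
(`…SmoothCutOut.lean`, the Jacobian criterion over a domain); its base change along any ring map to a
field is the reduced subscheme cut out by the Fermat form there (`…CutOutBaseChange.lean`), i.e. a
Fermat variety, which over `k` (`m ≠ 0` as `p ∤ m`) and over `K` (characteristic `0`, with an `m`-th
root of `-1` by Teichmüller) is a smooth projective geometrically integral `n`-fold
(`SmoothHypersurface.isSmoothHypersurface_hypersurface_fermatPolynomial`, transported along the
isomorphism with the standard model).

What is NOT here: the crystalline clauses of `IsPadicAnchor` (cohomological supersingularity —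
Shioda–Katsura 1979 with Tate 1965 — and torsion-free Hodge cohomology) and the `φ`-Tate property of
Hodge classes (Ogus 1982, Thm. 4.14): hypotheses on the classical package `C` in the tree's convention.

References: R. Hartshorne, *Algebraic Geometry* (1977), I Ex. 5.5, II Example 3.2.6, III Thm. 10.2
[Hartshorne1977]; T. Shioda, T. Katsura, *On Fermat varieties*, Tôhoku Math. J. 31 (1979) [ShiodaKatsura1979].
-/

-- the summit-side namespace `Summit.HodgeConjecture.HodgeConjecture.…` (summit = sub-problem, D-0017)
-- repeats a component by design; the linter would flag every declaration.
set_option linter.dupNamespace false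

noncomputable section

open CategoryTheory AlgebraicGeometry MvPolynomial
open scoped Isocrystal
open Literature.AlgebraicGeometry.Motives Literature.AlgebraicGeometry.Motives.WittScheme
  Literature.AlgebraicGeometry.Crystalline

universe u

namespace Summit.HodgeConjecture.HodgeConjecture.Theorems.AnchorsAtGenericHodgeLocusPoints

section Model

variable (p : ℕ) [Fact p.Prime] (k : Type u) [Field k]

/-- The Fermat form `Σ xᵢᵐ` (any commutative ring) is homogeneous of degree `m`. [folklore] -/
theorem isHomogeneous_sum_X_pow (O : Type u) [CommRing O] (n m : ℕ) :
    (∑ i : Fin (n + 2), (X i : MvPolynomial (Fin (n + 2)) O) ^ m).IsHomogeneous m :=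
  IsHomogeneous.sum _ _ _ fun i _ => by simpa using (isHomogeneous_X O i).pow m

/-- **A base change of a smooth Fermat-form cut-out over `W(k)` to a field is a Fermat variety**: if
`𝒳 → Spec W(k)` is smooth of relative dimension `n` and `ι : 𝒳 ⟶ ℙⁿ⁺¹_{W(k)}` is a closed immersion
onto `V₊(Σ xᵢᵐ)`, then for every ring homomorphism `φ : W(k) → L` to a field, `𝒳 ×_{W(k)} L` is a Fermat
variety `Xⁿₘ` over `L` (`…CutOutBaseChange.isHypersurfaceCutOutBy_baseChangeHom` and
`φ(Σ xᵢᵐ) = Σ xᵢᵐ`). [cite: Hartshorne1977, II Example 3.2.6] -/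
theorem isFermatVariety_baseChangeHom {n m : ℕ} (𝒳 : SchemeOver (WittVector p k))
    (h𝒳 : SmoothOfRelativeDimension n 𝒳.hom)
    (ι : 𝒳 ⟶ projectiveSpaceOver (n + 1) (WittVector p k)) [IsClosedImmersion ι.left]
    (hrange : letI := MvPolynomial.gradedAlgebra (σ := Fin (n + 2)) (R := WittVector p k)
      Set.range ι.left.base =
        ProjectiveSpectrum.zeroLocus (homogeneousSubmodule (Fin (n + 2)) (WittVector p k))
          {∑ i : Fin (n + 2), (X i : MvPolynomial (Fin (n + 2)) (WittVector p k)) ^ m})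
    {L : Type u} [Field L] (φ : WittVector p k →+* L) :
    IsFermatVariety n m ((baseChangeHom φ).obj 𝒳) := by
  have h := isHypersurfaceCutOutBy_baseChangeHom φ 𝒳 h𝒳 ι _ hrange
  rwa [map_sum_X_pow_eq_fermatPolynomial] at h

/-- **Iterated base change**: with `𝒳` as above and `ψ : W(k) → K'` any ring homomorphism, every
further base change of `𝒳 ×_{W(k)} K'` along a homomorphism `ι : K' → L` to a field is a Fermat
variety over `L` (base-change the cut-out data along `ψ` first, `…CutOutBaseChange`, then apply the
previous lemma's argument over `K'`). [cite: Hartshorne1977, II Example 3.2.6] -/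
theorem isFermatVariety_baseChangeHom_baseChangeHom {n m : ℕ} (𝒳 : SchemeOver (WittVector p k))
    (h𝒳 : SmoothOfRelativeDimension n 𝒳.hom)
    (ι : 𝒳 ⟶ projectiveSpaceOver (n + 1) (WittVector p k)) [IsClosedImmersion ι.left]
    (hrange : letI := MvPolynomial.gradedAlgebra (σ := Fin (n + 2)) (R := WittVector p k)
      Set.range ι.left.base =
        ProjectiveSpectrum.zeroLocus (homogeneousSubmodule (Fin (n + 2)) (WittVector p k))
          {∑ i : Fin (n + 2), (X i : MvPolynomial (Fin (n + 2)) (WittVector p k)) ^ m})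
    {K' : Type u} [CommRing K'] (ψ : WittVector p k →+* K') {L : Type u} [Field L] (φ : K' →+* L) :
    IsFermatVariety n m ((baseChangeHom φ).obj ((baseChangeHom ψ).obj 𝒳)) := by
  obtain ⟨ι', hι', hrange'⟩ := exists_closedImmersion_baseChangeHom_range_eq_singleton ψ 𝒳 ι _ hrange
  haveI := hι'
  rw [map_sum_X_pow] at hrange'
  have h := isHypersurfaceCutOutBy_baseChangeHom φ ((baseChangeHom ψ).obj 𝒳)
    (smoothOfRelativeDimension_baseChangeHom_hom ψ h𝒳) ι' _ hrange'
  rwa [map_sum_X_pow_eq_fermatPolynomial] at h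

variable [CharP k p]

/-- **The Fermat lift over `W(k)` is a smooth proper model with Fermat fibres.** For a prime `p ≠ 2`, an
algebraically closed field `k` of characteristic `p`, and `n ≥ 1`, `m ≥ 1` with `p ∤ m`, there is a
`W(k)`-scheme `𝒳` with: a closed `W(k)`-immersion into `ℙⁿ⁺¹_{W(k)}` onto `V₊(x₀ᵐ + ⋯ + x_{n+1}ᵐ)`
(verbatim the body of `Crystalline.IsFermatLift n m 𝒳`), `IsProjectiveOverRing 𝒳`, `𝒳` reduced, `WittScheme.IsSmoothProperModel n 𝒳`
(smooth of relative dimension `n` and proper over `W(k)`; special and generic fibre smooth projective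
geometrically integral `n`-folds), and the special fibre, the generic fibre and every base change of the
generic fibre along a field embedding `K = W(k)[1/p] → L` are Fermat varieties `Xⁿₘ`. (The reduced
cut-out of the Fermat form over the domain `W(k)`: nonsingular form since `m ∈ W(k)ˣ`; Jacobian
criterion over a domain; fibres by base change of cut-outs; smooth projectivity of the fibres from the
standard Fermat hypersurface over `k` — `m ≠ 0` — and over `K` — characteristic `0`, `m`-th root of `-1`
by Teichmüller.) [cite: Hartshorne1977, I Ex. 5.5 and III Thm. 10.2] -/
theorem exists_fermatLift_model [IsAlgClosed k] (hp : p ≠ 2) {n m : ℕ} (hn : 1 ≤ n) (hm : 1 ≤ m)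
    (hpm : ¬ p ∣ m) :
    ∃ 𝒳 : SchemeOver (WittVector p k),
      (letI := MvPolynomial.gradedAlgebra (σ := Fin (n + 2)) (R := WittVector p k)
        ∃ ι : 𝒳 ⟶ projectiveSpaceOver (n + 1) (WittVector p k), IsClosedImmersion ι.left ∧
          Set.range ι.left.base =
            ProjectiveSpectrum.zeroLocus (homogeneousSubmodule (Fin (n + 2)) (WittVector p k))
              {∑ i : Fin (n + 2), (X i : MvPolynomial (Fin (n + 2)) (WittVector p k)) ^ m}) ∧
      IsProjectiveOverRing 𝒳 ∧ IsReduced 𝒳.left ∧ IsSmoothProperModel n 𝒳 ∧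
      IsFermatVariety n m (specialFibre 𝒳) ∧ IsFermatVariety n m (genericFibre 𝒳) ∧
      ∀ (L : Type u) [Field L] (ι : K(p, k) →+* L),
        IsFermatVariety n m ((baseChangeHom ι).obj (genericFibre 𝒳)) := by
  -- the reduced cut-out of the (nonsingular, `p ∤ m`) Fermat form over the domain `W(k)`
  obtain ⟨𝒳, ι, hι, hred, hsm, hpr, hrange⟩ := exists_smooth_proper_cutOut
    (∑ i : Fin (n + 2), (X i : MvPolynomial (Fin (n + 2)) (WittVector p k)) ^ m)
    (isHomogeneous_sum_X_pow (WittVector p k) n m) (isNonsingularForm_fermat_wittVector p k hpm)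
    (by omega)
  haveI := hι
  -- its fibres are Fermat varieties …
  have hspecial : IsFermatVariety n m (specialFibre 𝒳) :=
    isFermatVariety_baseChangeHom p k 𝒳 hsm ι hrange WittVector.constantCoeff
  have hgeneric : IsFermatVariety n m (genericFibre 𝒳) :=
    isFermatVariety_baseChangeHom p k 𝒳 hsm ι hrange (algebraMap (WittVector p k) K(p, k))
  -- … hence smooth projective geometrically integral `n`-folds (standard models over `k` and `K`)
  have hspecial' : IsSmoothProjective n (specialFibre 𝒳) :=
    (SmoothHypersurface.isSmoothProjective_hypersurface_fermatPolynomial hn hm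
      (natCast_ne_zero_of_not_dvd p k hpm)).of_iso hspecial.nonempty_iso_hypersurface.some.symm
  have hgeneric' : IsSmoothProjective n (genericFibre 𝒳) := by
    obtain ⟨ζ, hζ⟩ := exists_pow_eq_neg_one_fractionRing p k hp hm
    exact (SmoothHypersurface.isSmoothHypersurface_hypersurface_fermatPolynomial hn hm
      (natCast_ne_zero_fractionRing_wittVector p k hm) hζ).1.of_iso
        hgeneric.nonempty_iso_hypersurface.some.symm
  refine ⟨𝒳, ⟨ι, hι, hrange⟩, ⟨n + 1, ι, hι⟩, hred, ⟨hsm, hpr, hspecial', hgeneric'⟩, hspecial,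
    hgeneric, fun L _ φ => ?_⟩
  exact isFermatVariety_baseChangeHom_baseChangeHom p k 𝒳 hsm ι hrange
    (algebraMap (WittVector p k) K(p, k)) φ

end Model

/-! ### The Fermat anchor at an anchor prime `p ≡ -1 (mod m)`, packaged -/

/-- **(B2), geometric clauses, at the anchor primes.** For `n ≥ 1`, `m ≥ 3` there is a prime `p` with
`p > n + 6`, `p ≡ -1 (mod m)` (so `m ∣ p + 1`, `p ∤ m`, `p ≠ 2`) and, over `W(𝔽̄_p)`
(`𝔽̄_p = AlgebraicClosure (ZMod p)`), a Fermat lift `𝒳` (closed `W`-immersion into `ℙⁿ⁺¹_W` onto `V₊(Σ xᵢᵐ)`) which is a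
reduced smooth proper model of relative dimension `n`, projective over `W(𝔽̄_p)`, whose special fibre,
generic fibre and all base changes of the generic fibre to fields (e.g. along `ι : K → ℂ`) are Fermat
varieties `Xⁿₘ`.
[cite: ShiodaKatsura1979, §3] [cite: Hartshorne1977, III Thm. 10.2] -/
theorem exists_fermat_anchor_model (n m : ℕ) (hn : 1 ≤ n) (hm : 3 ≤ m) :
    ∃ p : ℕ, ∃ _ : Fact p.Prime, n + 6 < p ∧ (p : ZMod m) = -1 ∧ m ∣ p + 1 ∧ ¬ p ∣ m ∧
      ∃ 𝒳 : SchemeOver (WittVector p (AlgebraicClosure (ZMod p))),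
        (letI := MvPolynomial.gradedAlgebra (σ := Fin (n + 2)) (R := WittVector p (AlgebraicClosure (ZMod p)))
          ∃ ι : 𝒳 ⟶ projectiveSpaceOver (n + 1) (WittVector p (AlgebraicClosure (ZMod p))),
            IsClosedImmersion ι.left ∧
            Set.range ι.left.base =
              ProjectiveSpectrum.zeroLocus
                (homogeneousSubmodule (Fin (n + 2)) (WittVector p (AlgebraicClosure (ZMod p))))
                {∑ i : Fin (n + 2),
                  (X i : MvPolynomial (Fin (n + 2)) (WittVector p (AlgebraicClosure (ZMod p)))) ^ m}) ∧
        IsProjectiveOverRing 𝒳 ∧ IsReduced 𝒳.left ∧ IsSmoothProperModel n 𝒳 ∧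
        IsFermatVariety n m (specialFibre 𝒳) ∧ IsFermatVariety n m (genericFibre 𝒳) ∧
        ∀ (L : Type) [Field L] (ι : K(p, AlgebraicClosure (ZMod p)) →+* L),
          IsFermatVariety n m ((baseChangeHom ι).obj (genericFibre 𝒳)) := by
  haveI : NeZero m := ⟨by omega⟩
  obtain ⟨p, hpn, hp, h⟩ := exists_prime_gt_and_eq_neg_one m n
  haveI : Fact p.Prime := ⟨hp⟩
  have hpm : ¬ p ∣ m := not_dvd_of_eq_neg_one h hp.ne_one
  -- `p ≠ 2`: `p ≡ -1 (mod m)` with `m ≥ 3` and `p > n + 6 ≥ 7`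
  have hp2 : p ≠ 2 := by omega
  obtain ⟨𝒳, hF, hproj, hred, hmodel, hs, hg, hL⟩ :=
    exists_fermatLift_model p (AlgebraicClosure (ZMod p)) hp2 hn (by omega) hpm
  exact ⟨p, ‹Fact p.Prime›, hpn, h, dvd_add_one_of_eq_neg_one h, hpm, 𝒳, hF, hproj, hred, hmodel,
    hs, hg, hL⟩

end Summit.HodgeConjecture.HodgeConjecture.Theorems.AnchorsAtGenericHodgeLocusPoints

end
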